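import Summits.BirchSwinnertonDyer.BirchSwinnertonDyer.Theorems.KimAtThreeDeepLowerOffStratumLevelLoweringMultiStabRowsFinal
import Literature.NumberTheory.EllipticCurves.LocalTorsionMultiplicativeProofs
import Literature.NumberTheory.EllipticCurves.PastenValuationProductThm115Proofs
import Literature.NumberTheory.EllipticCurves.RootNumberProofs
import Summits.BirchSwinnertonDyer.Rank1Residual.X11b.RouteR1BDPExists
import HarnessLib

/-!
# Route `KimAtThreeKolyvagin` (rung W2), crux `DeepLowerAtThreeOffKatoStratum` (item 19679), registered
# stub `stub_nonAdditive`: the CLASS «semistable, ordinary-if-good, `v₃(∏ c_ℓ) = 1`» WITHOUT row data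
# (the decomposition `N = M₀·D·q` is CONSTRUCTED from the curve)

Cell `bsd-addord`, seat `bsd-addord-w2-acc2`, gen 6; item `stmt-BirchSwinnertonDyer-19679` (`--supports`, closes
nothing). ★⁵′ (`…MultiStabRowsFinal.stub_nonAdditive_semistable_squarefree`) closes every semistable depth-`1` row of
the stub from THIRTEEN named facts GIVEN decidable row data (`M₀·D·q = N`, the Tamagawa-`3` prime `q`, the set
`D` of the other unramified primes, read off `ord_ℓ Δ`). THIS FILE removes the row data: for a SEMISTABLE curve
with `3 ∣ ∏ c_ℓ` there is a prime `q ∣ N` of SPLIT multiplicative reduction with `3 ∣ ord_q Δ` (Kodaira–Néron: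
`c_ℓ = ord_ℓ(Δ_min)` at a split, `∈ {1, 2}` at a non-split multiplicative prime, `= 1` at a good prime; `Tam(E)` is
the product of the `c_ℓ` over the bad places), and with `D := ∏ {r ∣ N/q prime : 3 ∣ ord_r Δ}`, `M₀ := N/(Dq)` the
displayed conditions of ★⁵′ hold by construction (square-free `N`). Hence the stub on the CLASS
`Semistable ∧ (good 3 → ordinary) ∧ v₃(∏ c_ℓ) ≤ 1 ∧ 3 ∣ ∏ c_ℓ` from the thirteen facts and NOTHING ELSE.
Theorems only; nothing booked; BSD is not proved by any of this.

* §1 `split_and_three_dvd_of_three_dvd_localTamagawaNumber`, `exists_split_prime_of_three_dvd_tamagawaProduct`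
  (square-free conductor: the tree's `Rank1Residual.X11b.squarefree_conductorNorm_of_semistable`, imported).
* §2 `exists_decomposition_of_squarefree` (pure arithmetic: `N = M₀·D·q` with the `ord`-conditions sorted).
* §3 ★⁶ `stub_nonAdditive_semistable_tamagawaDepthOne`.
-/

set_option autoImplicit false
-- the Theorems namespace of a single-conjunct summit repeats the summit name by design (D-0017)
set_option linter.dupNamespace false

noncomputable section

open scoped MatrixGroups ModularForm Classical NNReal NumberField

open CongruenceSubgroup WeierstrassCurve Literature.NumberTheory.EllipticCurves
  Literature.NumberTheory.EllipticCurves.ModularForms IsDedekindDomain NumberField Rat.HeightOneSpectrum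

namespace Summit.BirchSwinnertonDyer.BirchSwinnertonDyer.Theorems.KimAtThreeDeepLowerOffStratumLevelLoweringMultiStabRowsClass

open Summit.BirchSwinnertonDyer.BirchSwinnertonDyer.Theorems.KimAtThreeDeepLowerOffStratumLevelLoweringMultiStabRowsFinal
open Literature.NumberTheory.EllipticCurves.Rank1Residual Literature.NumberTheory.EllipticCurves.Rank1Residual.Typed
  Literature.NumberTheory.EllipticCurves.Skinner2016 Literature.NumberTheory.Automorphic

/-! ### §1 The Tamagawa-`3` prime of a semistable curve -/

section Tamagawa

variable (W : WeierstrassCurve ℚ) [W.IsElliptic] [W.IsGloballyMinimal]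

/-- **At a prime `q` of multiplicative reduction with `3 ∣ c_q`, the reduction is SPLIT and `3 ∣ ord_q(Δ_min)`**
(Kodaira–Néron: `c_q = ord_q(Δ_min)` in the split case, `c_q ∈ {1, 2}` in the non-split case).
[cite: SilvermanATAEC1994, Cor. IV.9.2(d), IV.9.4 Step 2] [cite: SilvermanAEC2009, Thm VII.6.1] -/
theorem split_and_three_dvd_of_three_dvd_localTamagawaNumber (q : ℕ) [hq : Fact q.Prime]
    (hmult : W.HasMultiplicativeReductionAtPrime q) (h3 : 3 ∣ (W.baseChange ℚ_[q]).localTamagawaNumber ℤ_[q]) :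
    W.HasSplitMultiplicativeReductionAtPrime q ∧ (3 : ℤ) ∣ padicValRat q W.Δ := by
  -- the place of `𝓞 ℚ` over `q`
  set v : HeightOneSpectrum (𝓞 ℚ) := (primesEquiv (R := 𝓞 ℚ)).symm ⟨q, hq.out⟩ with hvdef
  have hv : primesEquiv v = ⟨q, hq.out⟩ := Equiv.apply_symm_apply _ _
  have hvq : (primesEquiv v : ℕ) = q := congrArg Subtype.val hv
  have hmultv : W.HasMultiplicativeReductionAt v := by
    have key : ∀ r : Nat.Primes, primesEquiv v = r →
        (haveI := Fact.mk r.2; W.HasMultiplicativeReductionAtPrime (r : ℕ)) → W.HasMultiplicativeReductionAt v := by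
      rintro r rfl h
      exact (hasMultiplicativeReductionAtPrime_iff_hasMultiplicativeReductionAt_ringOfIntegers W v).mp h
    exact key ⟨q, hq.out⟩ hv hmult
  have hsplit : W.HasSplitMultiplicativeReductionAtPrime q ↔ W.HasSplitMultiplicativeReductionAt v := by
    have key : ∀ r : Nat.Primes, primesEquiv v = r →
        ((haveI := Fact.mk r.2; W.HasSplitMultiplicativeReductionAtPrime (r : ℕ)) ↔
          W.HasSplitMultiplicativeReductionAt v) := by
      rintro r rfl
      exact hasSplitMultiplicativeReductionAtPrime_iff_hasSplitMultiplicativeReductionAt W v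
    exact key ⟨q, hq.out⟩ hv
  haveI : Finite (IsLocalRing.ResidueField (v.adicCompletionIntegers ℚ)) :=
    HeightOneSpectrum.finite_residueField_adicCompletionIntegers ℚ v
  rw [localTamagawaNumber_padic_eq_holds W v q hvq] at h3
  by_cases hs : W.HasSplitMultiplicativeReductionAt v
  · refine ⟨hsplit.mpr hs, ?_⟩
    rw [localTamagawaNumber_eq_ordMinimalDiscriminant_of_hasSplitMultiplicativeReductionAt v W hs,
      LocalTorsionMult.ordMinimalDiscriminant_eq_padicValInt W v hvq] at h3
    rw [← cast_minimalDiscriminantInt W, padicValRat.of_int]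
    exact_mod_cast h3
  · exfalso
    rw [localTamagawaNumber_of_hasNonsplitMultiplicativeReductionAt_holds v W hmultv hs] at h3
    split_ifs at h3
    · have := Nat.le_of_dvd two_pos h3; omega
    · have := Nat.le_of_dvd one_pos h3; omega

/-- **The Tamagawa-`3` prime of a SEMISTABLE curve**: if `3 ∣ ∏_ℓ c_ℓ(E)` then some bad prime `q` has SPLIT
multiplicative reduction with `3 ∣ ord_q(Δ_min)` (`Tam(E) = ∏_{bad v} c_v`, `3` divides one factor, the prime is
bad hence multiplicative, and §1's first lemma). [cite: SilvermanATAEC1994, Cor. IV.9.2(d), IV.9.4 Step 2]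
[cite: SilvermanAEC2009, Thm VII.6.1 and VII.2 (c_v = 1 at good v)] -/
theorem exists_split_prime_of_three_dvd_tamagawaProduct (hsst : Semistable W) (h3 : 3 ∣ W.tamagawaProduct) :
    ∃ (q : ℕ) (_ : Fact q.Prime), q ∣ W.conductorNorm ℤ ∧ W.HasSplitMultiplicativeReductionAtPrime q ∧
      (3 : ℤ) ∣ padicValRat q W.Δ := by
  have hfW : (W.badPlaces ℤ).Finite := W.finite_badPlaces_holds ℤ
  set s : Finset (HeightOneSpectrum ℤ) := hfW.toFinset with hsdef
  have hsW : ∀ w, ¬ W.HasGoodReductionAt w → w ∈ s := fun w hw ↦ by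
    rw [hsdef, Set.Finite.mem_toFinset, mem_badPlaces_iff]; exact hw
  rw [tamagawaProduct_eq_prod W s hsW] at h3
  obtain ⟨v, hv, hdv⟩ := Nat.prime_three.prime.exists_mem_finset_dvd h3
  haveI := Fact.mk (primesEquiv v).2
  have hbad : ¬ W.HasGoodReductionAt v := by
    rw [hsdef, Set.Finite.mem_toFinset, mem_badPlaces_iff] at hv; exact hv
  have hbad' : ¬ W.HasGoodReductionAtPrime (primesEquiv v : ℕ) := fun hgood ↦
    hbad ((WeierstrassCurve.hasGoodReductionAtPrime_primesEquiv_iff_hasGoodReductionAt W v).mp hgood)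
  have hmult : W.HasMultiplicativeReductionAtPrime (primesEquiv v : ℕ) :=
    (hsst (primesEquiv v : ℕ) (primesEquiv v).2).resolve_left hbad'
  have hN : (primesEquiv v : ℕ) ∣ W.conductorNorm ℤ := by
    by_contra h
    exact hbad' (hasGoodReductionAtPrime_of_not_dvd_conductorNorm W h)
  obtain ⟨hs, hord⟩ := split_and_three_dvd_of_three_dvd_localTamagawaNumber W (primesEquiv v : ℕ) hmult hdv
  exact ⟨(primesEquiv v : ℕ), inferInstance, hN, hs, hord⟩

end Tamagawa

/-! ### §2 The decomposition `N = M₀·D·q` of a square-free level (pure arithmetic) -/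

section Arithmetic

/-- **Sorting the prime factors of a square-free `N`**: given a prime `q ∣ N` and a property `P` of primes,
`N = M₀·D·q` with `q ∤ M₀D`, `M₀D` square-free, every prime factor of `D` satisfying `P` and no prime factor of
`M₀` satisfying `P` (`D` = the product of the prime factors `r` of `N/q` with `P r`). [folklore] -/
theorem exists_decomposition_of_squarefree {N q : ℕ} (hN : Squarefree N) (hq : q.Prime) (hqN : q ∣ N)
    (P : ℕ → Prop) :
    ∃ M₀ D : ℕ, M₀ * D * q = N ∧ ¬ q ∣ M₀ * D ∧ Squarefree (M₀ * D) ∧ (∀ r : ℕ, r.Prime → r ∣ D → P r) ∧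
      (∀ p : ℕ, p.Prime → p ∣ M₀ → ¬ P p) := by
  classical
  obtain ⟨N', hN'⟩ := hqN
  have hsq' : Squarefree N' := fun x hx ↦ hN x (by rw [hN']; exact hx.mul_left q)
  have hqN' : ¬ q ∣ N' := by
    intro h
    have h2 : q * q ∣ N := by rw [hN']; exact mul_dvd_mul_left q h
    exact hq.one_lt.ne' (Nat.isUnit_iff.mp (hN q h2))
  set S : Finset ℕ := N'.primeFactors.filter (fun r ↦ P r) with hS
  set D : ℕ := ∏ r ∈ S, r with hD
  have hSsub : S ⊆ N'.primeFactors := Finset.filter_subset _ _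
  have hDdvd : D ∣ N' := by
    have h := Finset.prod_dvd_prod_of_subset S N'.primeFactors (fun r ↦ r) hSsub
    rwa [Nat.prod_primeFactors_of_squarefree hsq'] at h
  obtain ⟨M₀, hM₀⟩ := hDdvd
  refine ⟨M₀, D, ?_, ?_, ?_, ?_, ?_⟩
  · rw [hN', hM₀]; ring
  · rw [mul_comm, ← hM₀]; exact hqN'
  · rw [mul_comm, ← hM₀]; exact hsq'
  · intro r hr hrD
    obtain ⟨r', hr'S, hrr'⟩ := hr.prime.exists_mem_finset_dvd hrD
    have hr'p : r'.Prime := Nat.prime_of_mem_primeFactors (hSsub hr'S)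
    obtain rfl : r = r' := (Nat.prime_dvd_prime_iff_eq hr hr'p).mp hrr'
    exact (Finset.mem_filter.mp hr'S).2
  · intro p hp hpM hP
    have hpN' : p ∣ N' := by rw [hM₀]; exact hpM.mul_left D
    have hpS : p ∈ S := Finset.mem_filter.mpr ⟨Nat.mem_primeFactors.mpr ⟨hp, hpN', hsq'.ne_zero⟩, hP⟩
    have hpD : p ∣ D := Finset.dvd_prod_of_mem (fun r ↦ r) hpS
    have h2 : p * p ∣ N' := by rw [hM₀]; exact mul_dvd_mul hpD hpM
    exact hp.one_lt.ne' (Nat.isUnit_iff.mp (hsq' p h2))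

end Arithmetic

/-! ### §3 ★⁶ The class theorem: no row data -/

section Class

/-- ★⁶ **`stub_nonAdditive` (crux 19679 `DeepLowerAtThreeOffKatoStratum`) on the CLASS of SEMISTABLE depth-`1` rows —
stub binders VERBATIM + `Semistable W₀` + «ordinary if good at `3`» + `v₃(∏ c_ℓ) ≤ 1` + `3 ∣ ∏ c_ℓ` — from
THIRTEEN NAMED FACTS and NOTHING ELSE** (no decomposition of `N`, no `ord_ℓ Δ` data: the Tamagawa-`3` prime `q`,
the unramified set `D` and the optimal level `M₀` are constructed from the curve, §1–§2, and ★⁵′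
`…MultiStabRowsFinal.stub_nonAdditive_semistable_squarefree` is applied).
[cite: Edixhoven1997, Thm. 3.1] [cite: DarmonDiamondTaylor1995, Thm. 3.15 and Prop. 2.12]
[cite: Diamond1995RefinedSerre, Thm. 6.4 and Cor. 6.5] [cite: Ribet1990, Thm. 1.1] [cite: ColemanEdixhoven1998, Thm. 2.1]
[cite: Vatsal1999, §1 (1.6), Thm. (1.13)] [cite: GreenbergVatsal2000, §3 (17)–(19)] [cite: Ribet1984ICM, Thm. 4.1]
[cite: Skinner2016PacificMC, Thm. C (§1)] [cite: Mazur1978, Cor. 4.1] [cite: Kim2022StructureSelmer, Conj. 1.10 (PDF p. 8)]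
[cite: SilvermanATAEC1994, Cor. IV.9.2(d), IV.9.4 Step 2] -/
theorem stub_nonAdditive_semistable_tamagawaDepthOne
    (hRk : ribet1990_levelLowering_gamma0_newform_at_three_squarefree)
    (hCE : colemanEdixhoven1998_heckePolynomial_simpleRoots)
    (hV : vatsal1999_plusSymbol_congruence) (hGV : greenbergVatsal2000_plusSymbol_congruence)
    (hI : ribet1984_iharaLemma)
    (hSk : Skinner2016.thmC_padicValRat_bsd_rank_zero)
    (hmod : hasEntireLFunction_rat) (hGZK : rank_eq_analyticRank_of_analyticRank_le_one)
    (hM : mazur_not_dvd_maninConstant_of_odd)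
    (hBCDT : exists_isNewformOf) (hLL' : diamond1995_refinedSerre) :
    ∀ (W₀ : WeierstrassCurve ℚ) [W₀.IsElliptic] [W₀.IsGloballyMinimal],
      (∀ n : ℕ, W₀.HasSurjectiveModNGaloisRep (3 ^ n : ℕ)) → Finite W₀.sha →
      ∀ {N : ℕ} [NeZero N], N = W₀.conductorNorm ℤ →
      ∀ (D₀ : ModularParametrizationData W₀ N),
        (∀ z ∈ D₀.L.lattice, ∃ w ∈ periodLattice D₀.f, z = D₀.c * w) →
        (∀ (W₂ : WeierstrassCurve ℚ) [W₂.IsElliptic] (D₂ : ModularParametrizationData W₂ N),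
          D₂.f = D₀.f → D₀.modularDegree ≤ D₂.modularDegree) →
        (∀ r : ℚ, ratPlusSymbol D₀.f r ≠ 0 → 0 ≤ padicValRat 3 (ratPlusSymbol D₀.f r)) →
        kuriharaVanishingOrder W₀ 3 D₀.f = 0 →
        ¬ (haveI : Fact (Nat.Prime 3) := ⟨Nat.prime_three⟩; Addv W₀ 3) →
        Semistable W₀ →
        (W₀.HasGoodReductionAtPrime 3 → ¬ (3 : ℤ) ∣ W₀.frobeniusTrace 3) →
        padicValNat 3 W₀.tamagawaProduct ≤ 1 → 3 ∣ W₀.tamagawaProduct →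
        ∃ d : ℕ, kuriharaPartialDeepInfty W₀ 3 D₀.f = d ∧
          kuriharaPartial W₀ 3 D₀.f 0 ≤
            ((padicValNat 3 (Nat.card (AddCommGroup.primaryComponent W₀.sha 3)) + d : ℕ) : ℕ∞) := by
  intro W₀ _ _ htower hfin N _ hN D₀ hopt hdeg hint hord hnA hsst hordinary hv h3
  have hNsq : Squarefree N := by
    rw [hN]; exact Summit.BirchSwinnertonDyer.Rank1Residual.X11b.squarefree_conductorNorm_of_semistable hsst
  obtain ⟨q, hqF, hqN, hsplit, hqΔ⟩ := exists_split_prime_of_three_dvd_tamagawaProduct W₀ hsst h3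
  rw [← hN] at hqN
  obtain ⟨M₀, D, hMDq, hqMD, hMDsq, hDΔ, hMΔ⟩ :=
    exists_decomposition_of_squarefree hNsq hqF.out hqN (fun r ↦ (3 : ℤ) ∣ padicValRat r W₀.Δ)
  haveI : NeZero M₀ := ⟨fun h ↦ NeZero.ne N (by rw [← hMDq, h, zero_mul, zero_mul])⟩
  exact stub_nonAdditive_semistable_squarefree hRk hCE hV hGV hI hSk hmod hGZK hM hBCDT hLL' W₀ htower hfin hN D₀
    hopt hdeg hint hord hnA hsst hordinary hv hMDq hsplit hqMD hMDsq hqΔ hDΔ (fun p hp hpM _ ↦ hMΔ p hp hpM)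
    fun h3M ↦ hMΔ 3 Nat.prime_three h3M

end Class

end Summit.BirchSwinnertonDyer.BirchSwinnertonDyer.Theorems.KimAtThreeDeepLowerOffStratumLevelLoweringMultiStabRowsClass

end
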